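import Literature.Geometry.Kaehler.ComplexTorusPolarizedProductOfCMEllipticCurves
import Literature.Geometry.Kaehler.ComplexTorusProductOfCMEllipticCurves
import Literature.Geometry.Kaehler.ComplexTorusIsotropicDescent
import Mathlib.LinearAlgebra.Matrix.PosDef
import HarnessLib

/-!
# Polarized products of CM elliptic curves, II: the hermitian lattice `(L, H)` on `Kⁿ`,
# `deg ρ_h = ((Γ^{α_R})^♯ : Γ^{α_R})`, and principal ⟺ unimodular (Narbonne 2022, §2.3:
# Prop. 1, Remark 1 and Theorem 2 on objects, in coordinates; Theorem 1: `R`-lattices are polarizable)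

Layer `Literature/Geometry/Kaehler`, namespace `Literature.Geometry.Kaehler.ComplexTorus`; lane
`lit-hodgefound` (Track 2 foundations library), family `hodge`; FILE 2 of the row «polarized products of
CM elliptic curves» — sequel of `ComplexTorusPolarizedProductOfCMEllipticCurves` (FILE 1: Lemma 1 and
Theorem 2 on objects, basis-free: the polarizations `ω` of a torus `X = E/Γ` with `R`-stable lattice,
`R = φ(𝓞_K) = ℤ[ω₀]`, `α = Im φ(ω₀) > 0`, ARE the integral positive-definite hermitian `R`-lattices
`(Γ^α, h^α)`, `h = hermOf ω`) and of `ComplexTorusProductOfCMEllipticCurves` (an `R`-stable lattice has an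
ideal-product presentation `C : E ≃ ℂⁿ`, `C(Γ) = φ(𝔞₁) × ⋯ × φ(𝔞ₙ)`).  THEOREMS ONLY: no definition, no
named fact (net debt `0`).

## Source, VERBATIM

F. Narbonne, *Polarized products of elliptic curves with complex multiplication and field of moduli `ℚ`*,
arXiv:2203.11982 (2022) [Narbonne2022PolarizedProductsCM], held `paper:arxiv-2203.11982` p0006–p0007:

* §2.2–§2.3: "we can always write `L` as a sum `L = ⊕ᵢ₌₁^g 𝔞ᵢxᵢ` with a basis `x₁, …, x_g` of the
  `K`-vector space `L ⊗_R K` and fractional ideals `𝔞₁, …, 𝔞_g` of `R`." "A hermitian `R`-lattice is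
  defined as couple `(L, H)` with `L` a `R`-lattice and `H` a positive definite hermitian form on the
  ambient space `KL`. […] The dual lattice `L^♯` of a hermitian lattice is the lattice defined by
  `L^♯ = {v ∈ V, H(v, L) ⊆ R}`. […] `(L, H)` is said to be integral if `H(L, L) ⊆ R` […] A hermitian
  lattice `(L, H)` which is `R`-modular is called unimodular, it is equivalent to the conditions `(L, H)`
  is integral and its scale is `𝔰(L) = (1) = R`."
* proof of Theorem 1: "If we endow `R^g` with the canonical hermitian form `h₀(x, y) = ᵗx ȳ`, we have
  `h₀(R^g, R^g) = R` […] Thus, `(R^g, (1/α_R) h₀)` defines a polarized torus and so does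
  `(Γ, (n²/α_R) h₀)`. This proves that the underlying `ℤ`-lattice of a `R`-lattice `Γ` is polarizable."
* "**Proposition 1.** Let `(V/Γ, ρ_h)` be a polarized torus such that `Γ ≃ ⊕ᵢ Λᵢ` with `End_ℂ(Λᵢ) ≃ R`
  with `R = ℤ[ω]`. Then `𝔰(Γ^{α_R})` is an integral ideal of `R`. Moreover, we have the relation
  `deg ρ_h = ((Γ^{α_R})^♯ : Γ^{α_R})`.  *Proof.* […] `deg ρ_h = (Γ̂ : ρ_h(Γ)) = (ρ_h⁻¹(Γ̂) : Γ)
  = #{v ∈ V, Im h(v, Γ) ⊆ ℤ}/Γ = #{v ∈ V, (Im ω)h(v, Γ) ⊆ R}/Γ` (by Lemma 1) `= #((Γ^{α_R})^♯/Γ)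
  = ((Γ^{α_R})^♯ : Γ^{α_R})`."
* "**Remark 1.** […] classes of principally polarized tori `(Γ, h)`, i.e., with `deg ρ_h = 1` correspond
  to isometry classes of integral lattices which scale has norm `1` and it is an integral ideal by
  Proposition 1. So it corresponds to unimodular lattices."
* "**Theorem 2.** […] `(X = V/Γ, ρ_h) ↦ (Γ^{α_R}, h^{α_R})`, `((L ⊗ ℂ)/L, H^{1/α_R}) ↤ (L, H)`."

## What is formalised (theorems only), and on which carriers

As in FILE 1: `X = E/Ψ(ℤ^ι)`, Riemann forms `IsRiemannForm Ψ ω`, `h = hermOf ω`, an integral basis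
`b = (1, ω₀)` of `𝓞_K`, `φ : K →+* ℂ`, `α = Im φ(ω₀)`, `R = (φ.comp (algebraMap (𝓞 K) K)).range`.  An
ideal-product presentation of the lattice is `(𝔞, C, hC)`: `𝔞ᵢ` invertible fractional ideals of `𝓞_K`,
`C : E ≃L[ℂ] ℂⁿ`, `hC : C(Γ) = L_𝔞 := {v | vᵢ ∈ φ(𝔞ᵢ)}` EXACTLY (`ComplexTorusSteinitzClass`,
`…Classification`); Narbonne's hermitian form on `Kⁿ ⊗ ℂ = ℂⁿ` with Gram matrix `M` is written in
Mathlib's convention `H_M(u, v) = v̄ ⬝ (M u) = Σᵢⱼ v̄ᵢ Mᵢⱼ uⱼ` (`star v ⬝ᵥ M *ᵥ u`; `ℂ`-linear in `u`,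
hermitian iff `Mᴴ = M`, positive definite = `Matrix.PosDef M`); the degree `deg ρ_h = #K(h)` is the
order of the tree's `kerPhiH Ψ G` (`= |det G|`, `G` the integer Gram matrix of `ω` on the lattice basis,
`ComplexTorusIsogenyDegree`, Lange Prop. 1.4.7).

* §1 `smul_latticeVec_of_image_eq_pi` (a lattice with an ideal-product presentation is `R`-stable);
  **THEOREM 2 in coordinates, `→`: `IsRiemannForm.exists_matrix_mul_hermOf_eq`** — for a polarization
  `ω`, the Gram matrix `M` of `α·h` transported by `C` satisfies `α·h(u, v) = H_M(Cu, Cv)`, is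
  `Matrix.PosDef`, has entries in `φ(K)` ("hermitian form on the ambient space `KL`") and is integral
  on `L_𝔞` (`H_M(L_𝔞, L_𝔞) ⊆ R`); **`←`: `existsUnique_isRiemannForm_of_posDef`** — every positive
  definite `M` integral on `L_𝔞` is `α·h` of a unique polarization, transported by `C`.
* §2 **THEOREM 1 (proof), "the underlying `ℤ`-lattice of a `R`-lattice is polarizable":
  `isAbelianVariety_of_image_eq_pi`** (from `h₀ = ᵗx ȳ` scaled by `|φ(d)|²`, `d𝔞ᵢ ⊆ 𝓞_K`) and
  **`isAbelianVariety_of_smul_latticeVec`** — EVERY complex torus whose lattice is stable under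
  `φ(𝓞_K)`, `K` imaginary quadratic, is an abelian variety.
* §3 **PROPOSITION 1, second sentence: `proj_mem_kerPhiH_iff_forall_mul_hermOf_mem`** (`K(h) =
  (Γ^{α_R})^♯/Γ^{α_R}` inside `X`: `π(x) ∈ K(h) ⟺ α·h(Ψx, Γ) ⊆ R`, by Lemma 1 applied to the `R`-module
  `α·h(Ψx, Γ)`) and **`natCard_setOf_forall_mul_hermOf_mem`**: `deg ρ_h = |det G| =
  #((Γ^{α_R})^♯/Γ^{α_R})`.
* §4 **REMARK 1: `isPrincipalPolarization_iff_forall_exists_intVec`** — `ω` is a PRINCIPAL polarization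
  iff it is a polarization and `(Γ^{α_R}, h^{α_R})` is unimodular (`(Γ^α)^♯ = Γ^α`:
  `α·h(Ψx, Γ) ⊆ R ⇒ x ∈ ℤ^ι`).
* §5 validation at the identity Gram matrix: **`exists_isPrincipalPolarization_of_image_eq_pi_one`** —
  `X ≅ ℂⁿ/(R × ⋯ × R) = E_Rⁿ` carries the PRINCIPAL polarization `h₀/α_R`, `h₀(x, y) = ᵗx ȳ` ("`(R^g,
  (1/α_R) h₀)` defines a polarized torus"; `(R^g, h₀)` is unimodular).

## References
* [Narbonne2022PolarizedProductsCM] F. Narbonne, arXiv:2203.11982 (2022), §2.2–§2.3: Thm. 1 (proof),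
  Prop. 1, Remark 1, Thm. 2.
* [Lange2023AbelianVarietiesComplex] H. Lange, *Abelian Varieties over the Complex Numbers* (2023),
  §1.4.2 (1.14) and Prop. 1.4.7 (`K(L) = Λ(L)/Λ`, `deg φ_L = det Im H`), §2.1.1.
-/

noncomputable section

open Module Complex NumberField Matrix
open scoped ComplexConjugate ComplexOrder nonZeroDivisors Pointwise

namespace Literature.Geometry.Kaehler

namespace ComplexTorus

variable {K : Type} [Field K] (φ : K →+* ℂ)
variable {ι : Type*} {E : Type*} [NormedAddCommGroup E] [NormedSpace ℂ E]

/-! ## §0. Sesquilinear calculus for `H_M(u, v) = v̄ ⬝ (M u)` and for `hermOf` -/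

section Sesq

variable {n : ℕ}

/-- `u = Σⱼ uⱼ eⱼ` in `ℂⁿ`. [folklore] -/
private theorem eq_sum_smul_single (u : Fin n → ℂ) : u = ∑ j, u j • (Pi.single j (1 : ℂ) : Fin n → ℂ) := by
  ext k
  simp [Finset.sum_apply, Pi.single_apply]

/-- `H_M(u, v) = Σᵢ Σⱼ v̄ᵢ Mᵢⱼ uⱼ`. [folklore] -/
private theorem star_dotProduct_mulVec_eq_sum (M : Matrix (Fin n) (Fin n) ℂ) (u v : Fin n → ℂ) :
    star v ⬝ᵥ M *ᵥ u = ∑ i, ∑ j, conj (v i) * M i j * u j := by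
  simp only [dotProduct, Matrix.mulVec, Pi.star_apply, RCLike.star_def, Finset.mul_sum, mul_assoc]

/-- `H_M` is additive in `u`. [folklore] -/
private theorem sesq_add_left (M : Matrix (Fin n) (Fin n) ℂ) (u u' v : Fin n → ℂ) :
    star v ⬝ᵥ M *ᵥ (u + u') = star v ⬝ᵥ M *ᵥ u + star v ⬝ᵥ M *ᵥ u' := by
  rw [Matrix.mulVec_add, dotProduct_add]

/-- `H_M` is `ℂ`-linear in `u`. [folklore] -/
private theorem sesq_smul_left (M : Matrix (Fin n) (Fin n) ℂ) (c : ℂ) (u v : Fin n → ℂ) :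
    star v ⬝ᵥ M *ᵥ (c • u) = c * (star v ⬝ᵥ M *ᵥ u) := by
  rw [Matrix.mulVec_smul, dotProduct_smul, smul_eq_mul]

/-- For a hermitian `M` (`conj Mⱼᵢ = Mᵢⱼ`), `H_M(v, u) = conj H_M(u, v)`. [folklore] -/
private theorem sesq_swap {M : Matrix (Fin n) (Fin n) ℂ} (hM : ∀ i j, conj (M j i) = M i j)
    (u v : Fin n → ℂ) : star u ⬝ᵥ M *ᵥ v = conj (star v ⬝ᵥ M *ᵥ u) := by
  rw [star_dotProduct_mulVec_eq_sum, star_dotProduct_mulVec_eq_sum, map_sum, Finset.sum_comm]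
  refine Finset.sum_congr rfl fun i _ ↦ ?_
  rw [map_sum]
  refine Finset.sum_congr rfl fun j _ ↦ ?_
  rw [map_mul, map_mul, Complex.conj_conj, hM j i]
  ring

/-- `H_M(eⱼ, eᵢ) = Mᵢⱼ`. [folklore] -/
private theorem sesq_single_single (M : Matrix (Fin n) (Fin n) ℂ) (i j : Fin n) :
    star (Pi.single i (1 : ℂ) : Fin n → ℂ) ⬝ᵥ M *ᵥ (Pi.single j (1 : ℂ)) = M i j := by
  rw [← Pi.single_star, star_one, Matrix.mulVec_single_one, single_one_dotProduct]
  rfl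

/-- `h(v, cw) = c̄ h(v, w)` for a `(1,1)`-form. [cite: Lange2023AbelianVarietiesComplex, §1.2.2 Lemma 1.2.10] -/
private theorem hermOf_smul_right' {η : E [⋀^Fin 2]→L[ℝ] ℝ}
    (h11 : ∀ u v : E, η ![I • u, I • v] = η ![u, v]) (c : ℂ) (v w : E) :
    hermOf η v (c • w) = conj c * hermOf η v w := by
  rw [hermOf_swap η h11 (c • w) v, hermOf_smul_left, map_mul, ← hermOf_swap η h11 w v]

/-- `h(Σⱼ cⱼ xⱼ, w) = Σⱼ cⱼ h(xⱼ, w)`. [cite: Lange2023AbelianVarietiesComplex, §1.2.2 Lemma 1.2.10] -/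
private theorem hermOf_sum_smul_left (η : E [⋀^Fin 2]→L[ℝ] ℝ) (c : Fin n → ℂ) (x : Fin n → E)
    (w : E) : hermOf η (∑ j, c j • x j) w = ∑ j, c j * hermOf η (x j) w := by
  have h : hermOf η (∑ j, c j • x j) w = hermOfCLM η w (∑ j, c j • x j) := rfl
  rw [h, map_sum]
  simp only [map_smul, hermOfCLM_apply, smul_eq_mul]

/-- `h(v, Σᵢ dᵢ yᵢ) = Σᵢ d̄ᵢ h(v, yᵢ)` for a `(1,1)`-form. [cite: Lange2023AbelianVarietiesComplex, §1.2.2 Lemma 1.2.10] -/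
private theorem hermOf_sum_smul_right {η : E [⋀^Fin 2]→L[ℝ] ℝ}
    (h11 : ∀ u v : E, η ![I • u, I • v] = η ![u, v]) (v : E) (d : Fin n → ℂ) (y : Fin n → E) :
    hermOf η v (∑ i, d i • y i) = ∑ i, conj (d i) * hermOf η v (y i) := by
  rw [hermOf_swap η h11 _ v, hermOf_sum_smul_left, map_sum]
  refine Finset.sum_congr rfl fun i _ ↦ ?_
  rw [map_mul, ← hermOf_swap η h11 (y i) v]

end Sesq

/-! ## §1. Theorem 2 in coordinates: the hermitian lattice `(L_𝔞, H_M)` on `Kⁿ` of a polarization -/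

section Coordinates

variable {n : ℕ}

/-- **A lattice with an ideal-product presentation is an `R`-module**: if `C(Γ) = φ(𝔞₁) × ⋯ × φ(𝔞ₙ)`
then `φ(a)Γ ⊆ Γ` for `a ∈ 𝓞_K` (the `𝔞ᵢ` are `𝓞_K`-modules).
[cite: Narbonne2022PolarizedProductsCM, §2.2 (proof of Thm. 1: "`RΓ = Γ`")] -/
theorem smul_latticeVec_of_image_eq_pi {Ψ : (ι → ℝ) ≃L[ℝ] E}
    (𝔞 : Fin n → (FractionalIdeal (𝓞 K)⁰ K)ˣ) (C : E ≃L[ℂ] (Fin n → ℂ))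
    (hC : ∀ v : Fin n → ℂ, (∃ m : ι → ℤ, C (latticeVec Ψ m) = v) ↔
      ∀ i, v i ∈ ⇑φ '' ((𝔞 i : FractionalIdeal (𝓞 K)⁰ K) : Set K))
    (a : 𝓞 K) (m : ι → ℤ) : ∃ m' : ι → ℤ, (φ (a : K)) • latticeVec Ψ m = latticeVec Ψ m' := by
  have hm : ∀ i, C (latticeVec Ψ m) i ∈ ⇑φ '' ((𝔞 i : FractionalIdeal (𝓞 K)⁰ K) : Set K) :=
    (hC _).1 ⟨m, rfl⟩
  have h' : ∀ i, C ((φ (a : K)) • latticeVec Ψ m) i ∈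
      ⇑φ '' ((𝔞 i : FractionalIdeal (𝓞 K)⁰ K) : Set K) := fun i ↦ by
    obtain ⟨x, hx, hxe⟩ := hm i
    refine ⟨(a : K) * x, ?_, ?_⟩
    · rw [← smul_eq_mul]
      exact (𝔞 i : FractionalIdeal (𝓞 K)⁰ K).val.smul_mem a hx
    · rw [map_smul, Pi.smul_apply, smul_eq_mul, map_mul, hxe]
  obtain ⟨m', hm'⟩ := (hC _).2 h'
  exact ⟨m', (C.injective hm').symm⟩

/-- For a non-zero fractional ideal there is a non-zero element in it. [folklore] -/
private theorem exists_mem_ne_zero (𝔞 : (FractionalIdeal (𝓞 K)⁰ K)ˣ) :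
    ∃ a : K, a ∈ (𝔞 : FractionalIdeal (𝓞 K)⁰ K) ∧ a ≠ 0 := by
  have h : ((𝔞 : FractionalIdeal (𝓞 K)⁰ K) : Submodule (𝓞 K) K) ≠ ⊥ :=
    FractionalIdeal.coeToSubmodule_ne_bot.mpr (Units.ne_zero 𝔞)
  obtain ⟨a, ha, ha0⟩ := Submodule.exists_mem_ne_zero_of_ne_bot h
  exact ⟨a, ha, ha0⟩

/-- `conj φ(K) ⊆ φ(K)` for a quadratic `K` (`K = Frac 𝓞_K`, `𝓞_K = ℤ + ℤω`, `ω̄ = t − ω`). [folklore] -/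
private theorem conj_mem_fieldRange [NumberField K] (b : Basis (Fin 2) ℤ (𝓞 K)) (hb : b 0 = 1)
    (hφ : (φ (b 1 : K)).im ≠ 0) (k : K) : conj (φ k) ∈ φ.fieldRange := by
  obtain ⟨x, y, -, hxy⟩ := IsFractionRing.div_surjective (A := 𝓞 K) k
  rw [← hxy, map_div₀, map_div₀]
  have hx : conj (φ (algebraMap (𝓞 K) K x)) ∈ φ.fieldRange := by
    obtain ⟨r, hr⟩ := conj_mem_range φ b hb hφ (z := φ (algebraMap (𝓞 K) K x)) ⟨x, rfl⟩
    exact ⟨(r : K), hr⟩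
  have hy : conj (φ (algebraMap (𝓞 K) K y)) ∈ φ.fieldRange := by
    obtain ⟨r, hr⟩ := conj_mem_range φ b hb hφ (z := φ (algebraMap (𝓞 K) K y)) ⟨y, rfl⟩
    exact ⟨(r : K), hr⟩
  exact div_mem hx hy

/-- **Narbonne 2022, Theorem 2 on objects in coordinates, `(X, ρ_h) ↦ (Γ^{α_R}, h^{α_R})` as a
hermitian `R`-lattice `(L, H)` on `Kⁿ`.**  Let `X = E/Ψ(ℤ^ι)` have the ideal-product presentation
`C : E ≃ ℂⁿ`, `C(Γ) = L_𝔞 = φ(𝔞₁) × ⋯ × φ(𝔞ₙ)` (so `L = ⊕ 𝔞ᵢeᵢ ⊂ Kⁿ`, `KL = Kⁿ`, `V = Kⁿ ⊗ ℂ = ℂⁿ`),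
`R = φ(𝓞_K) = ℤ[ω₀]`, `α = Im φ(ω₀) > 0`, and let `ω` be a polarization of `X` with hermitian form
`h = hermOf ω`. Then the Gram matrix `M = (α·h(C⁻¹eⱼ, C⁻¹eᵢ))ᵢⱼ` of `h^α` in the coordinates `C`
satisfies: `α·h(u, v) = H_M(Cu, Cv)` for all `u, v` (`H_M(x, y) = ȳ ⬝ Mx`); `M` is positive definite
hermitian (`Matrix.PosDef`); its entries lie in `φ(K)` ("a positive definite hermitian form on the
ambient space `KL`"); and `H_M(L_𝔞, L_𝔞) ⊆ R` ("integral", Prop. 1 first sentence).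
[cite: Narbonne2022PolarizedProductsCM, §2.3 Thm. 2 and Prop. 1 (with §2.2–§2.3 definitions)] -/
theorem IsRiemannForm.exists_matrix_mul_hermOf_eq [NumberField K] (b : Basis (Fin 2) ℤ (𝓞 K))
    (hb : b 0 = 1) (hα : 0 < (φ (b 1 : K)).im) {Ψ : (ι → ℝ) ≃L[ℝ] E} {ω : E [⋀^Fin 2]→L[ℝ] ℝ}
    (hω : IsRiemannForm Ψ ω) (𝔞 : Fin n → (FractionalIdeal (𝓞 K)⁰ K)ˣ) (C : E ≃L[ℂ] (Fin n → ℂ))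
    (hC : ∀ v : Fin n → ℂ, (∃ m : ι → ℤ, C (latticeVec Ψ m) = v) ↔
      ∀ i, v i ∈ ⇑φ '' ((𝔞 i : FractionalIdeal (𝓞 K)⁰ K) : Set K)) :
    ∃ M : Matrix (Fin n) (Fin n) ℂ,
      (∀ u v : E, ((φ (b 1 : K)).im : ℂ) * hermOf ω u v = star (C v) ⬝ᵥ M *ᵥ (C u)) ∧
      M.PosDef ∧ (∀ i j, M i j ∈ φ.fieldRange) ∧
      ∀ u v : Fin n → ℂ, (∀ i, u i ∈ ⇑φ '' ((𝔞 i : FractionalIdeal (𝓞 K)⁰ K) : Set K)) →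
        (∀ i, v i ∈ ⇑φ '' ((𝔞 i : FractionalIdeal (𝓞 K)⁰ K) : Set K)) →
        star v ⬝ᵥ M *ᵥ u ∈ (φ.comp (algebraMap (𝓞 K) K)).range := by
  classical
  have hφ : (φ (b 1 : K)).im ≠ 0 := hα.ne'
  set α : ℝ := (φ (b 1 : K)).im with hαdef
  set e : Fin n → (Fin n → ℂ) := fun j ↦ Pi.single j (1 : ℂ) with he
  set M : Matrix (Fin n) (Fin n) ℂ :=
    Matrix.of fun i j ↦ (α : ℂ) * hermOf ω (C.symm (e j)) (C.symm (e i)) with hMdef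
  have hMij : ∀ i j, M i j = (α : ℂ) * hermOf ω (C.symm (e j)) (C.symm (e i)) := fun i j ↦ rfl
  -- the identity `α·h(C⁻¹x, C⁻¹y) = H_M(x, y)` on `ℂⁿ`, by sesquilinearity on the basis `eⱼ`
  have hident' : ∀ x y : Fin n → ℂ,
      (α : ℂ) * hermOf ω (C.symm x) (C.symm y) = star y ⬝ᵥ M *ᵥ x := by
    intro x y
    rw [star_dotProduct_mulVec_eq_sum]
    conv_lhs => rw [eq_sum_smul_single x, eq_sum_smul_single y, map_sum, map_sum]
    simp only [map_smul]
    rw [hermOf_sum_smul_left]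
    simp_rw [hermOf_sum_smul_right hω.1, hMij]
    rw [Finset.mul_sum]
    simp_rw [Finset.mul_sum]
    rw [Finset.sum_comm]
    refine Finset.sum_congr rfl fun i _ ↦ Finset.sum_congr rfl fun j _ ↦ ?_
    ring
  have hident : ∀ u v : E, (α : ℂ) * hermOf ω u v = star (C v) ⬝ᵥ M *ᵥ (C u) := fun u v ↦ by
    have h := hident' (C u) (C v)
    rwa [C.symm_apply_apply, C.symm_apply_apply] at h
  -- hermitian
  have hherm : ∀ i j, conj (M j i) = M i j := fun i j ↦ by
    rw [hMij, hMij, map_mul, Complex.conj_ofReal, ← hermOf_swap ω hω.1]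
  -- `R`-stability of the lattice and integrality (FILE 1, Prop. 1 first sentence)
  have hΛ := smul_latticeVec_of_image_eq_pi φ 𝔞 C hC
  have hint : ∀ u v : Fin n → ℂ, (∀ i, u i ∈ ⇑φ '' ((𝔞 i : FractionalIdeal (𝓞 K)⁰ K) : Set K)) →
      (∀ i, v i ∈ ⇑φ '' ((𝔞 i : FractionalIdeal (𝓞 K)⁰ K) : Set K)) →
      star v ⬝ᵥ M *ᵥ u ∈ (φ.comp (algebraMap (𝓞 K) K)).range := by
    intro u v hu hv
    obtain ⟨m, rfl⟩ := (hC u).2 hu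
    obtain ⟨m', rfl⟩ := (hC v).2 hv
    rw [← hident]
    exact hω.mul_hermOf_latticeVec_mem φ b hb hφ hΛ m m'
  refine ⟨M, hident, ?_, fun i j ↦ ?_, hint⟩
  · -- positive definite
    refine Matrix.PosDef.of_dotProduct_mulVec_pos (Matrix.IsHermitian.ext fun i j ↦ hherm i j)
      fun x hx ↦ ?_
    have hw : C.symm x ≠ 0 := fun h0 ↦ hx (by simpa using congrArg C h0)
    rw [← hident', hermOf_apply, twoForm_self, Complex.ofReal_zero, zero_mul, add_zero,
      ← Complex.ofReal_mul]
    exact Complex.zero_lt_real.mpr (mul_pos hα (hω.2.2 _ hw))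
  · -- entries in `φ(K)`: `Mᵢⱼ = H_M(φ(aⱼ)eⱼ, φ(aᵢ)eᵢ) / (conj φ(aᵢ) · φ(aⱼ))`, `aₖ ∈ 𝔞ₖ ∖ 0`
    obtain ⟨ai, hai, hai0⟩ := exists_mem_ne_zero (K := K) (𝔞 i)
    obtain ⟨aj, haj, haj0⟩ := exists_mem_ne_zero (K := K) (𝔞 j)
    have hmemL : ∀ (k : Fin n) (a : K), a ∈ (𝔞 k : FractionalIdeal (𝓞 K)⁰ K) →
        ∀ l, (φ a • e k) l ∈ ⇑φ '' ((𝔞 l : FractionalIdeal (𝓞 K)⁰ K) : Set K) := by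
      intro k a ha l
      by_cases hl : l = k
      · subst hl
        exact ⟨a, ha, by simp [he]⟩
      · exact ⟨0, (𝔞 l : FractionalIdeal (𝓞 K)⁰ K).val.zero_mem, by simp [he, hl]⟩
    have hval : star (φ ai • e i) ⬝ᵥ M *ᵥ (φ aj • e j) = conj (φ ai) * φ aj * M i j := by
      rw [sesq_smul_left, star_smul, smul_dotProduct, smul_eq_mul, sesq_single_single]
      simp only [RCLike.star_def]
      ring
    have hR := hint _ _ (hmemL j aj haj) (hmemL i ai hai)
    rw [hval] at hR
    obtain ⟨r, hr⟩ := hR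
    have hne : conj (φ ai) * φ aj ≠ 0 :=
      mul_ne_zero ((map_ne_zero _).mpr ((map_ne_zero φ).mpr hai0)) ((map_ne_zero φ).mpr haj0)
    have hMij' : M i j = φ (algebraMap (𝓞 K) K r) / (conj (φ ai) * φ aj) := by
      rw [eq_div_iff hne]
      rw [RingHom.comp_apply] at hr
      rw [hr]
      ring
    rw [hMij']
    exact div_mem (φ.mem_fieldRange_self _)
      (mul_mem (conj_mem_fieldRange φ b hb hφ ai) (φ.mem_fieldRange_self _))

/-- **Narbonne 2022, Theorem 2 on objects in coordinates, `((L ⊗ ℂ)/L, H^{1/α_R}) ↤ (L, H)`.**  With the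
presentation `C(Γ) = L_𝔞 = ∏ φ(𝔞ᵢ)` as above and `α = Im φ(ω₀) > 0`: every positive definite hermitian
matrix `M` over `ℂ` which is integral on the `R`-lattice `L_𝔞` (`H_M(L_𝔞, L_𝔞) ⊆ R`,
`H_M(x, y) = ȳ ⬝ Mx`) is the Gram matrix of `h^α = α·hermOf ω` for a UNIQUE polarization `ω` of `X`.
[cite: Narbonne2022PolarizedProductsCM, §2.3 Thm. 2] -/
theorem existsUnique_isRiemannForm_of_posDef [Fintype ι] (b : Basis (Fin 2) ℤ (𝓞 K)) (hb : b 0 = 1)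
    (hα : 0 < (φ (b 1 : K)).im) (Ψ : (ι → ℝ) ≃L[ℝ] E) (𝔞 : Fin n → (FractionalIdeal (𝓞 K)⁰ K)ˣ)
    (C : E ≃L[ℂ] (Fin n → ℂ))
    (hC : ∀ v : Fin n → ℂ, (∃ m : ι → ℤ, C (latticeVec Ψ m) = v) ↔
      ∀ i, v i ∈ ⇑φ '' ((𝔞 i : FractionalIdeal (𝓞 K)⁰ K) : Set K))
    (M : Matrix (Fin n) (Fin n) ℂ) (hM : M.PosDef)
    (hint : ∀ u v : Fin n → ℂ, (∀ i, u i ∈ ⇑φ '' ((𝔞 i : FractionalIdeal (𝓞 K)⁰ K) : Set K)) →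
      (∀ i, v i ∈ ⇑φ '' ((𝔞 i : FractionalIdeal (𝓞 K)⁰ K) : Set K)) →
      star v ⬝ᵥ M *ᵥ u ∈ (φ.comp (algebraMap (𝓞 K) K)).range) :
    ∃! ω : E [⋀^Fin 2]→L[ℝ] ℝ, IsRiemannForm Ψ ω ∧
      ∀ u v : E, ((φ (b 1 : K)).im : ℂ) * hermOf ω u v = star (C v) ⬝ᵥ M *ᵥ (C u) := by
  have hherm : ∀ i j, conj (M j i) = M i j := fun i j ↦ hM.1.apply i j
  refine existsUnique_isRiemannForm_mul_hermOf_eq φ b hb hα Ψ (fun u v ↦ star (C v) ⬝ᵥ M *ᵥ (C u))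
    (fun u u' v ↦ by rw [map_add, sesq_add_left]) (fun c u v ↦ by rw [map_smul, sesq_smul_left])
    (fun u v ↦ sesq_swap hherm (C u) (C v)) (fun u hu ↦ ?_) fun m m' ↦ ?_
  · have hx : C u ≠ 0 := fun h0 ↦ hu (by simpa using congrArg C.symm h0)
    have h := hM.dotProduct_mulVec_pos hx
    exact (Complex.lt_def.mp h).1
  · exact hint _ _ ((hC _).1 ⟨m, rfl⟩) ((hC _).1 ⟨m', rfl⟩)

end Coordinates

/-! ## §2. Theorem 1 (proof): "the underlying `ℤ`-lattice of a `R`-lattice `Γ` is polarizable" -/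

section Polarizable

variable {n : ℕ}

/-- `Re(x̄ ⬝ x) = Σ |xᵢ|² > 0` for `x ≠ 0` (`h₀(x, x) > 0`). [folklore] -/
private theorem re_star_dotProduct_self_pos {x : Fin n → ℂ} (hx : x ≠ 0) :
    0 < (star x ⬝ᵥ x).re := by
  have h : star x ⬝ᵥ x = ((∑ i, Complex.normSq (x i) : ℝ) : ℂ) := by
    push_cast
    simp only [dotProduct, Pi.star_apply, RCLike.star_def, Complex.normSq_eq_conj_mul_self]
  rw [h, Complex.ofReal_re]
  obtain ⟨i, hi⟩ := Function.ne_iff.mp hx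
  exact Finset.sum_pos' (fun j _ ↦ Complex.normSq_nonneg _)
    ⟨i, Finset.mem_univ _, Complex.normSq_pos.mpr hi⟩

/-- A common denominator: `d ∈ 𝓞_K ∖ 0` with `d𝔞ᵢ ⊆ 𝓞_K` for all `i` ("there exists an integer `n`
such that `n𝔞ᵢ ⊆ R`, for all `i`"). [cite: Narbonne2022PolarizedProductsCM, §2.2 (proof of Thm. 1)] -/
private theorem exists_denominator [NumberField K] (𝔞 : Fin n → (FractionalIdeal (𝓞 K)⁰ K)ˣ) :
    ∃ d : 𝓞 K, d ≠ 0 ∧ ∀ i, ∀ a ∈ (𝔞 i : FractionalIdeal (𝓞 K)⁰ K), ∃ r : 𝓞 K,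
      algebraMap (𝓞 K) K r = (d : K) * a := by
  classical
  -- each `𝔞ᵢ` has a denominator `dᵢ`
  have hden : ∀ i, ∀ a ∈ (𝔞 i : FractionalIdeal (𝓞 K)⁰ K), ∃ r : 𝓞 K,
      algebraMap (𝓞 K) K r = ((𝔞 i : FractionalIdeal (𝓞 K)⁰ K).den : 𝓞 K) • a := by
    intro i a ha
    have h1 : (𝔞 i : FractionalIdeal (𝓞 K)⁰ K).den • a ∈
        (𝔞 i : FractionalIdeal (𝓞 K)⁰ K).den •
          ((𝔞 i : FractionalIdeal (𝓞 K)⁰ K) : Submodule (𝓞 K) K) :=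
      Submodule.smul_mem_pointwise_smul a _ _ ha
    rw [FractionalIdeal.den_mul_self_eq_num] at h1
    obtain ⟨r, -, hr⟩ := h1
    refine ⟨r, ?_⟩
    rw [Algebra.linearMap_apply] at hr
    rw [hr, Submonoid.smul_def]
  set d : 𝓞 K := ∏ i, ((𝔞 i : FractionalIdeal (𝓞 K)⁰ K).den : 𝓞 K) with hd
  have hd0 : d ≠ 0 := by
    rw [hd, Finset.prod_ne_zero_iff]
    exact fun i _ ↦ nonZeroDivisors.coe_ne_zero _
  refine ⟨d, hd0, fun i a ha ↦ ?_⟩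
  obtain ⟨r, hr⟩ := hden i a ha
  refine ⟨(∏ k ∈ Finset.univ.erase i, ((𝔞 k : FractionalIdeal (𝓞 K)⁰ K).den : 𝓞 K)) * r, ?_⟩
  rw [map_mul, hr, Algebra.smul_def, ← mul_assoc, ← map_mul, Finset.prod_erase_mul _ _
    (Finset.mem_univ i)]

/-- **Narbonne 2022, proof of Theorem 1: "the underlying `ℤ`-lattice of a `R`-lattice `Γ` is
polarizable".**  A complex torus `X = E/Ψ(ℤ^ι)` whose lattice has an ideal-product presentation
`C(Γ) = φ(𝔞₁) × ⋯ × φ(𝔞ₙ)` (`K` imaginary quadratic: `[K : ℚ] = 2`, `φ` not real) is an abelian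
variety: the canonical form `h₀(x, y) = ᵗx ȳ` scaled by `|φ(d)|²` (`d𝔞ᵢ ⊆ 𝓞_K`) is an integral positive
definite hermitian form on `Γ`, hence (FILE 1, Theorem 2 `←`) `|φ(d)|² h₀ / α_R` is a polarization.
[cite: Narbonne2022PolarizedProductsCM, §2.2 Thm. 1 (proof)] -/
theorem isAbelianVariety_of_image_eq_pi [NumberField K] [Fintype ι] (h2 : finrank ℚ K = 2)
    (hφ : ¬ ComplexEmbedding.IsReal φ) (Ψ : (ι → ℝ) ≃L[ℝ] E)
    (𝔞 : Fin n → (FractionalIdeal (𝓞 K)⁰ K)ˣ) (C : E ≃L[ℂ] (Fin n → ℂ))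
    (hC : ∀ v : Fin n → ℂ, (∃ m : ι → ℤ, C (latticeVec Ψ m) = v) ↔
      ∀ i, v i ∈ ⇑φ '' ((𝔞 i : FractionalIdeal (𝓞 K)⁰ K) : Set K)) :
    IsAbelianVariety Ψ := by
  classical
  obtain ⟨b, hb, hα⟩ := exists_basis_zero_eq_one_im_pos φ h2 hφ
  obtain ⟨d, hd0, hd⟩ := exists_denominator (K := K) 𝔞
  set c : ℂ := φ (d : K) with hc
  -- `H(u, v) = Σᵢ conj(c (Cv)ᵢ) · (c (Cu)ᵢ) = |c|² h₀(Cu, Cv)`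
  obtain ⟨ω, hω, -⟩ := exists_isRiemannForm_mul_hermOf_eq φ b hb hα Ψ
    (fun u v ↦ conj c * c * (star (C v) ⬝ᵥ (C u)))
    (fun u u' v ↦ by rw [map_add, dotProduct_add, mul_add])
    (fun a u v ↦ by rw [map_smul, dotProduct_smul, smul_eq_mul]; ring)
    (fun u v ↦ by
      rw [map_mul, map_mul, Complex.conj_conj, star_dotProduct, RCLike.star_def]
      ring)
    (fun u hu ↦ by
      have hx : C u ≠ 0 := fun h0 ↦ hu (by simpa using congrArg C.symm h0)
      have hcc : conj c * c = (Complex.normSq c : ℂ) := Complex.normSq_eq_conj_mul_self.symm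
      rw [hcc, Complex.re_ofReal_mul]
      exact mul_pos (Complex.normSq_pos.mpr ((map_ne_zero φ).mpr
        (by exact_mod_cast hd0))) (re_star_dotProduct_self_pos hx))
    (fun m m' ↦ by
      have hu := (hC _).1 ⟨m, rfl⟩
      have hv := (hC _).1 ⟨m', rfl⟩
      -- `conj c · c · Σᵢ conj vᵢ uᵢ = Σᵢ conj(c vᵢ) (c uᵢ)`, each factor in `R`
      have hexp : conj c * c * (star (C (latticeVec Ψ m')) ⬝ᵥ C (latticeVec Ψ m)) =
          ∑ i, conj (c * C (latticeVec Ψ m') i) * (c * C (latticeVec Ψ m) i) := by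
        simp only [dotProduct, Pi.star_apply, RCLike.star_def, Finset.mul_sum, map_mul]
        refine Finset.sum_congr rfl fun i _ ↦ ?_
        ring
      rw [hexp]
      refine Subring.sum_mem _ fun i _ ↦ Subring.mul_mem _ ?_ ?_
      · obtain ⟨a, ha, hae⟩ := hv i
        obtain ⟨r, hr⟩ := hd i a ha
        refine conj_mem_range φ b hb hα.ne' ⟨r, ?_⟩
        rw [RingHom.comp_apply, hr, map_mul, hae]
      · obtain ⟨a, ha, hae⟩ := hu i
        obtain ⟨r, hr⟩ := hd i a ha
        refine ⟨r, ?_⟩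
        rw [RingHom.comp_apply, hr, map_mul, hae])
  exact ⟨ω, hω⟩

/-- **Every complex torus whose period lattice is stable under `φ(𝓞_K)`, `K` imaginary quadratic, is an
abelian variety** ("the underlying `ℤ`-lattice of a `R`-lattice is polarizable" — with the pseudo-basis
`Γ ≅ ⊕ 𝔞ᵢxᵢ` of `ComplexTorusProductOfCMEllipticCurves.exists_equiv_image_lattice_eq_pi`).
[cite: Narbonne2022PolarizedProductsCM, §2.2 Thm. 1 (proof)] -/
theorem isAbelianVariety_of_smul_latticeVec [NumberField K] [Fintype ι] [DecidableEq ι]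
    [FiniteDimensional ℂ E] (h2 : finrank ℚ K = 2) (hφ : ¬ ComplexEmbedding.IsReal φ)
    (Ψ : (ι → ℝ) ≃L[ℝ] E)
    (hΛ : ∀ (a : 𝓞 K) (m : ι → ℤ), ∃ m' : ι → ℤ, (φ (a : K)) • latticeVec Ψ m = latticeVec Ψ m') :
    IsAbelianVariety Ψ := by
  obtain ⟨𝔞, C, hC⟩ := exists_equiv_image_lattice_eq_pi φ h2 Ψ hΛ
  exact isAbelianVariety_of_image_eq_pi φ h2 hφ Ψ 𝔞 C hC

end Polarizable

/-! ## §3. Proposition 1, second sentence: `deg ρ_h = ((Γ^{α_R})^♯ : Γ^{α_R})` -/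

section Degree

variable [Fintype ι] [DecidableEq ι]

/-- **`K(h) = (Γ^{α_R})^♯ / Γ^{α_R}` inside `X`** (the two middle equalities of the proof of Prop. 1:
"`#{v ∈ V, Im h(v, Γ) ⊆ ℤ}/Γ = #{v ∈ V, (Im ω)h(v, Γ) ⊆ R}/Γ` (by Lemma 1)"): for a polarization `ω`
of a torus with `R`-stable lattice and its integer Gram matrix `G`, a point `π(x) ∈ X` lies in the
kernel `K(h)` of `ρ_h = φ_H : X → X̂` iff `α·h(Ψx, γ) ∈ R` for all `γ ∈ Γ` — Lemma 1 applied to the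
`R`-module `α·h(Ψx, Γ)` (`R`-stable through the second, antilinear slot since `R̄ = R`).
[cite: Narbonne2022PolarizedProductsCM, §2.3 Prop. 1 (proof)] -/
theorem proj_mem_kerPhiH_iff_forall_mul_hermOf_mem (b : Basis (Fin 2) ℤ (𝓞 K)) (hb : b 0 = 1)
    (hφ : (φ (b 1 : K)).im ≠ 0) {Ψ : (ι → ℝ) ≃L[ℝ] E} {ω : E [⋀^Fin 2]→L[ℝ] ℝ}
    (hω : IsRiemannForm Ψ ω)
    (hΛ : ∀ (a : 𝓞 K) (m : ι → ℤ), ∃ m' : ι → ℤ, (φ (a : K)) • latticeVec Ψ m = latticeVec Ψ m')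
    {G : Matrix ι ι ℤ} (hG : G.map (Int.cast : ℤ → ℝ) = latticeGram Ψ ω) (x : ι → ℝ) :
    proj Ψ x ∈ kerPhiH Ψ G ↔
      ∀ m : ι → ℤ, ((φ (b 1 : K)).im : ℂ) * hermOf ω (Ψ x) (latticeVec Ψ m) ∈
        (φ.comp (algebraMap (𝓞 K) K)).range := by
  rw [proj_mem_kerPhiH_iff Ψ ω hG]
  constructor
  · intro h
    set S : Set ℂ := {z | ∃ m : ι → ℤ, z = ((φ (b 1 : K)).im : ℂ) * hermOf ω (Ψ x) (latticeVec Ψ m)}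
      with hSdef
    -- `α·h(Ψx, Γ)` is an `R`-module: `φ(r)·h(v, γ) = h(v, conj φ(r)·γ)` and `conj φ(r) ∈ R`
    have hS : ∀ (r : 𝓞 K), ∀ s ∈ S, φ (r : K) * s ∈ S := by
      rintro r s ⟨m, rfl⟩
      obtain ⟨r', hr'⟩ := conj_mem_range φ b hb hφ (z := φ (r : K)) ⟨r, rfl⟩
      obtain ⟨m', hm'⟩ := hΛ r' m
      refine ⟨m', ?_⟩
      have hc : conj (φ (r' : K)) = φ (r : K) := by
        rw [RingHom.comp_apply] at hr'
        change φ (r' : K) = _ at hr'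
        rw [hr', Complex.conj_conj]
      rw [← hm', hermOf_smul_right' hω.1, hc]
      ring
    have him : ∀ s ∈ S, ∃ q : ℤ, s.im = q * (φ (b 1 : K)).im := by
      rintro s ⟨m, rfl⟩
      obtain ⟨k, hk⟩ := h m
      refine ⟨k, ?_⟩
      rw [Complex.im_ofReal_mul, hermOf_im]
      change (φ (b 1 : K)).im * ω ![Ψ x, Ψ (intVec m)] = _
      rw [hk, mul_comm]
    exact fun m ↦ (subset_range_iff_forall_im φ b hb hφ hS).mpr him ⟨m, rfl⟩
  · intro h m
    obtain ⟨q, hq⟩ := exists_int_im_eq_of_mem_range φ b hb (h m)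
    rw [Complex.im_ofReal_mul, hermOf_im] at hq
    exact ⟨q, mul_left_cancel₀ hφ (hq.trans (mul_comm _ _))⟩

/-- **Narbonne 2022, Proposition 1, second sentence: "`deg ρ_h = ((Γ^{α_R})^♯ : Γ^{α_R})`".**  The
degree of the polarization `ρ_h : X → X̂` — the order of its kernel `K(h)`, `= |det G|` for the integer
Gram matrix `G` of `ω = Im h` (Lange Prop. 1.4.7) — equals the number of points `π(x)` of `X` with
`α·h(Ψx, Γ) ⊆ R`, i.e. the index of `Γ^{α_R}` in its hermitian dual
`(Γ^{α_R})^♯ = {v ∈ V, h^{α_R}(v, Γ) ⊆ R}`.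
[cite: Narbonne2022PolarizedProductsCM, §2.3 Prop. 1] -/
theorem natCard_setOf_forall_mul_hermOf_mem (b : Basis (Fin 2) ℤ (𝓞 K)) (hb : b 0 = 1)
    (hφ : (φ (b 1 : K)).im ≠ 0) {Ψ : (ι → ℝ) ≃L[ℝ] E} {ω : E [⋀^Fin 2]→L[ℝ] ℝ}
    (hω : IsRiemannForm Ψ ω)
    (hΛ : ∀ (a : 𝓞 K) (m : ι → ℤ), ∃ m' : ι → ℤ, (φ (a : K)) • latticeVec Ψ m = latticeVec Ψ m')
    {G : Matrix ι ι ℤ} (hG : G.map (Int.cast : ℤ → ℝ) = latticeGram Ψ ω) :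
    Nat.card {t : ComplexTorus Ψ // ∃ x : ι → ℝ, proj Ψ x = t ∧
      ∀ m : ι → ℤ, ((φ (b 1 : K)).im : ℂ) * hermOf ω (Ψ x) (latticeVec Ψ m) ∈
        (φ.comp (algebraMap (𝓞 K) K)).range} = G.det.natAbs := by
  rw [← natCard_kerPhiH Ψ G]
  refine Nat.card_congr (Equiv.subtypeEquivRight fun t ↦ ?_)
  constructor
  · rintro ⟨x, rfl, hx⟩
    exact (proj_mem_kerPhiH_iff_forall_mul_hermOf_mem φ b hb hφ hω hΛ hG x).2 hx
  · intro ht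
    obtain ⟨z, rfl⟩ := cover_surjective Ψ t
    refine ⟨Ψ.symm z, rfl, ?_⟩
    exact (proj_mem_kerPhiH_iff_forall_mul_hermOf_mem φ b hb hφ hω hΛ hG (Ψ.symm z)).1 ht

/-- **`deg ρ_h = ((Γ^{α_R})^♯ : Γ^{α_R})` with the tree's degree function**: the index equals
`|polarizationDegree Ψ ω| = |det (latticeGram Ψ ω)|` (Lange Prop. 1.4.7 `deg φ_L = det Im H`).
[cite: Narbonne2022PolarizedProductsCM, §2.3 Prop. 1] [cite: Lange2023AbelianVarietiesComplex, §1.4.2 Prop. 1.4.7] -/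
theorem natCard_setOf_forall_mul_hermOf_mem_eq_abs_polarizationDegree (b : Basis (Fin 2) ℤ (𝓞 K))
    (hb : b 0 = 1) (hφ : (φ (b 1 : K)).im ≠ 0) {Ψ : (ι → ℝ) ≃L[ℝ] E} {ω : E [⋀^Fin 2]→L[ℝ] ℝ}
    (hω : IsRiemannForm Ψ ω)
    (hΛ : ∀ (a : 𝓞 K) (m : ι → ℤ), ∃ m' : ι → ℤ, (φ (a : K)) • latticeVec Ψ m = latticeVec Ψ m') :
    (Nat.card {t : ComplexTorus Ψ // ∃ x : ι → ℝ, proj Ψ x = t ∧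
      ∀ m : ι → ℤ, ((φ (b 1 : K)).im : ℂ) * hermOf ω (Ψ x) (latticeVec Ψ m) ∈
        (φ.comp (algebraMap (𝓞 K) K)).range} : ℝ) = |polarizationDegree Ψ ω| := by
  obtain ⟨G, hG⟩ := hω.exists_intMatrix_latticeGram
  rw [natCard_setOf_forall_mul_hermOf_mem φ b hb hφ hω hΛ hG, ← natCard_kerPhiH Ψ G,
    natCard_kerPhiH_eq_abs_polarizationDegree Ψ ω hG]

end Degree

/-! ## §4. Remark 1: principally polarized ⟺ `(Γ^{α_R}, h^{α_R})` unimodular -/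

section Unimodular

variable [Fintype ι] [DecidableEq ι]

/-- **Narbonne 2022, Remark 1: "classes of principally polarized tori `(Γ, h)`, i.e., with
`deg ρ_h = 1` correspond to […] unimodular lattices".**  A real `2`-form `ω` is a PRINCIPAL polarization
of the torus `X = E/Ψ(ℤ^ι)` with `R`-stable lattice iff it is a polarization whose integral hermitian
lattice `(Γ^{α_R}, h^{α_R})` (Prop. 1) is unimodular: `(Γ^{α_R})^♯ = Γ^{α_R}`, i.e. every `v = Ψx`
with `α·h(v, Γ) ⊆ R` lies in `Γ` (`x ∈ ℤ^ι`).  (`deg ρ_h = #K(h) = 1 ⟺ K(h) = 0`.)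
[cite: Narbonne2022PolarizedProductsCM, §2.3 Remark 1 (with Prop. 1)] -/
theorem isPrincipalPolarization_iff_forall_exists_intVec (b : Basis (Fin 2) ℤ (𝓞 K)) (hb : b 0 = 1)
    (hφ : (φ (b 1 : K)).im ≠ 0) (Ψ : (ι → ℝ) ≃L[ℝ] E)
    (hΛ : ∀ (a : 𝓞 K) (m : ι → ℤ), ∃ m' : ι → ℤ, (φ (a : K)) • latticeVec Ψ m = latticeVec Ψ m')
    (ω : E [⋀^Fin 2]→L[ℝ] ℝ) :
    IsPrincipalPolarization Ψ ω ↔ IsRiemannForm Ψ ω ∧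
      ∀ x : ι → ℝ, (∀ m : ι → ℤ, ((φ (b 1 : K)).im : ℂ) * hermOf ω (Ψ x) (latticeVec Ψ m) ∈
        (φ.comp (algebraMap (𝓞 K) K)).range) → ∃ k : ι → ℤ, x = intVec k := by
  constructor
  · intro hp
    have hR := hp.isRiemannForm
    obtain ⟨G, hG⟩ := hR.exists_intMatrix_latticeGram
    have hbot := (hR.isPrincipalPolarization_iff_kerPhiH_eq_bot hG).1 hp
    refine ⟨hR, fun x hx ↦ ?_⟩
    have hmem := (proj_mem_kerPhiH_iff_forall_mul_hermOf_mem φ b hb hφ hR hΛ hG x).2 hx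
    rw [hbot, AddSubgroup.mem_bot] at hmem
    exact (proj_eq_zero_iff Ψ).1 hmem
  · rintro ⟨hR, h⟩
    obtain ⟨G, hG⟩ := hR.exists_intMatrix_latticeGram
    rw [hR.isPrincipalPolarization_iff_kerPhiH_eq_bot hG, eq_bot_iff]
    intro t ht
    obtain ⟨z, rfl⟩ := cover_surjective Ψ t
    have hx := (proj_mem_kerPhiH_iff_forall_mul_hermOf_mem φ b hb hφ hR hΛ hG (Ψ.symm z)).1 ht
    obtain ⟨k, hk⟩ := h _ hx
    rw [AddSubgroup.mem_bot]
    change proj Ψ (Ψ.symm z) = 0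
    rw [hk]
    exact proj_intVec Ψ k

/-- **Remark 1, degree form: `deg ρ_h = 1 ⟺ (Γ^{α_R})^♯ = Γ^{α_R}`** — for a polarization, the index
`((Γ^{α_R})^♯ : Γ^{α_R})` is `1` iff the polarization is principal.
[cite: Narbonne2022PolarizedProductsCM, §2.3 Remark 1] -/
theorem isPrincipalPolarization_iff_natCard_eq_one (b : Basis (Fin 2) ℤ (𝓞 K)) (hb : b 0 = 1)
    (hφ : (φ (b 1 : K)).im ≠ 0) {Ψ : (ι → ℝ) ≃L[ℝ] E} {ω : E [⋀^Fin 2]→L[ℝ] ℝ}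
    (hω : IsRiemannForm Ψ ω)
    (hΛ : ∀ (a : 𝓞 K) (m : ι → ℤ), ∃ m' : ι → ℤ, (φ (a : K)) • latticeVec Ψ m = latticeVec Ψ m') :
    IsPrincipalPolarization Ψ ω ↔
      Nat.card {t : ComplexTorus Ψ // ∃ x : ι → ℝ, proj Ψ x = t ∧
        ∀ m : ι → ℤ, ((φ (b 1 : K)).im : ℂ) * hermOf ω (Ψ x) (latticeVec Ψ m) ∈
          (φ.comp (algebraMap (𝓞 K) K)).range} = 1 := by
  obtain ⟨G, hG⟩ := hω.exists_intMatrix_latticeGram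
  rw [natCard_setOf_forall_mul_hermOf_mem φ b hb hφ hω hΛ hG, ← natCard_kerPhiH Ψ G,
    hω.isPrincipalPolarization_iff_kerPhiH_eq_bot hG, AddSubgroup.eq_bot_iff_card]

end Unimodular

/-! ## §5. Validation: the standard unimodular lattice `(Rⁿ, h₀)` — `E_Rⁿ` is principally polarized -/

section Standard

variable {n : ℕ} [Fintype ι] [DecidableEq ι]

/-- For the trivial presentation `C(Γ) = R × ⋯ × R` (`𝔞ᵢ = (1)`): membership in `L_𝔞` is membership of
every coordinate in `R = φ(𝓞_K)`. [cite: Narbonne2022PolarizedProductsCM, §2.2 (proof of Thm. 1: `R^g`)] -/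
private theorem mem_image_one_iff (z : ℂ) :
    z ∈ ⇑φ '' (((1 : (FractionalIdeal (𝓞 K)⁰ K)ˣ) : FractionalIdeal (𝓞 K)⁰ K) : Set K) ↔
      z ∈ (φ.comp (algebraMap (𝓞 K) K)).range := by
  constructor
  · rintro ⟨x, hx, rfl⟩
    obtain ⟨r, rfl⟩ := (FractionalIdeal.mem_one_iff _).mp hx
    exact ⟨r, rfl⟩
  · rintro ⟨r, rfl⟩
    exact ⟨(r : K), (FractionalIdeal.mem_one_iff _).mpr ⟨r, rfl⟩, rfl⟩

/-- **"If we endow `R^g` with the canonical hermitian form `h₀(x, y) = ᵗx ȳ`, we have `h₀(R^g, R^g) = R`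
[…] Thus, `(R^g, (1/α_R) h₀)` defines a polarized torus"** — and since `(R^g, h₀)` is UNIMODULAR
(`(R^g)^♯ = {v, h₀(v, eⱼ) = vⱼ ∈ R ∀ j} = R^g`), Remark 1 makes `h₀/α_R` a PRINCIPAL polarization: the torus
`X = E/Γ ≅ ℂⁿ/(R × ⋯ × R) = E_Rⁿ` (`E_R = ℂ/φ(𝓞_K)`) carries a principal polarization `ω₀` with
`α·hermOf ω₀ (u, v) = ᵗ(Cu) (C̄v)` — the validation instance of Theorem 2 / Remark 1 at the identity
Gram matrix. [cite: Narbonne2022PolarizedProductsCM, §2.2 Thm. 1 (proof) and §2.3 Remark 1] -/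
theorem exists_isPrincipalPolarization_of_image_eq_pi_one (b : Basis (Fin 2) ℤ (𝓞 K)) (hb : b 0 = 1)
    (hα : 0 < (φ (b 1 : K)).im) (Ψ : (ι → ℝ) ≃L[ℝ] E) (C : E ≃L[ℂ] (Fin n → ℂ))
    (hC : ∀ v : Fin n → ℂ, (∃ m : ι → ℤ, C (latticeVec Ψ m) = v) ↔
      ∀ i, v i ∈ ⇑φ '' (((1 : (FractionalIdeal (𝓞 K)⁰ K)ˣ) : FractionalIdeal (𝓞 K)⁰ K) : Set K)) :
    ∃ ω : E [⋀^Fin 2]→L[ℝ] ℝ, IsPrincipalPolarization Ψ ω ∧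
      ∀ u v : E, ((φ (b 1 : K)).im : ℂ) * hermOf ω u v = star (C v) ⬝ᵥ (C u) := by
  classical
  have hφ : (φ (b 1 : K)).im ≠ 0 := hα.ne'
  have hC' : ∀ v : Fin n → ℂ, (∃ m : ι → ℤ, C (latticeVec Ψ m) = v) ↔
      ∀ i, v i ∈ (φ.comp (algebraMap (𝓞 K) K)).range := fun v ↦ by
    rw [hC]
    exact forall_congr' fun i ↦ mem_image_one_iff φ (v i)
  -- the polarization `h₀/α` (FILE 1, Theorem 2 `←`, with `H = h₀ ∘ C`)
  obtain ⟨ω, hω, hωH⟩ := exists_isRiemannForm_mul_hermOf_eq φ b hb hα Ψ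
    (fun u v ↦ star (C v) ⬝ᵥ (C u))
    (fun u u' v ↦ by rw [map_add, dotProduct_add])
    (fun a u v ↦ by rw [map_smul, dotProduct_smul, smul_eq_mul])
    (fun u v ↦ by rw [star_dotProduct, RCLike.star_def])
    (fun u hu ↦ re_star_dotProduct_self_pos fun h0 ↦ hu (by simpa using congrArg C.symm h0))
    (fun m m' ↦ by
      have hu := (hC' _).1 ⟨m, rfl⟩
      have hv := (hC' _).1 ⟨m', rfl⟩
      simp only [dotProduct, Pi.star_apply, RCLike.star_def]
      exact Subring.sum_mem _ fun i _ ↦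
        Subring.mul_mem _ (conj_mem_range φ b hb hφ (hv i)) (hu i))
  refine ⟨ω, ?_, hωH⟩
  -- `R`-stability of `Γ` (an ideal-product presentation with `𝔞ᵢ = (1)`)
  have hΛ := smul_latticeVec_of_image_eq_pi φ (fun _ : Fin n ↦ (1 : (FractionalIdeal (𝓞 K)⁰ K)ˣ)) C hC
  -- unimodular: `α·h(Ψx, Γ) ⊆ R ⇒ (CΨx)ⱼ = α·h(Ψx, C⁻¹eⱼ) ∈ R ⇒ Ψx ∈ Γ`
  refine (isPrincipalPolarization_iff_forall_exists_intVec φ b hb hφ Ψ hΛ ω).2 ⟨hω, fun x hx ↦ ?_⟩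
  have hcoord : ∀ j, C (Ψ x) j ∈ (φ.comp (algebraMap (𝓞 K) K)).range := fun j ↦ by
    -- `eⱼ ∈ L`, so `eⱼ = C(Ψ mⱼ)`
    have hej : ∀ i, (Pi.single j (1 : ℂ) : Fin n → ℂ) i ∈ (φ.comp (algebraMap (𝓞 K) K)).range :=
      fun i ↦ by
      by_cases hi : i = j
      · subst hi; exact ⟨1, by simp⟩
      · exact ⟨0, by simp [hi]⟩
    obtain ⟨mj, hmj⟩ := (hC' _).2 hej
    have h := hx mj
    rw [hωH, hmj, ← Pi.single_star, star_one, single_one_dotProduct] at h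
    exact h
  obtain ⟨m, hm⟩ := (hC' (C (Ψ x))).2 hcoord
  refine ⟨m, ?_⟩
  have h := C.injective hm
  change Ψ (intVec m) = Ψ x at h
  exact (Ψ.injective h).symm

end Standard

end ComplexTorus

end Literature.Geometry.Kaehler

end
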